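import Literature.AnabelianGeometry.EtaleTheta.Discharge.Sec2AutKTransfer
import Literature.AnabelianGeometry.EtaleTheta.Discharge.Sec2AutKDihedral
import Literature.AnabelianGeometry.EtaleTheta.Discharge.Sec2AutKNormalizersC
import Mathlib.GroupTheory.IndexNormal

/-!
# [EtTh] Remark 2.6.1, clause `X̲` (`Aut_K(X̲) = ℤ/lℤ ⋊ {±1}`) and Remark 2.9.1 DISCHARGED
# unconditionally; `Aut_K(C̲̲) = Π^tp_{C̲}/Π^tp_{C̲̲}` (proof-only companion of `ThetaCoversTempered.lean`)

Mochizuki, *The Étale Theta Function …* [EtTh], Publ. RIMS 45 (2009), §2, Remark 2.6.1 p.40 and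
Remark 2.9.1 p.43 (PRIMS text, locators = PDF pages; bib key `MochizukiEtTh2009`): "`Aut_K(X̲^log) =
ℤ/lℤ ⋊ {±1}`", "`Aut_K(C̲̲^log) = μ_l`" [cite: MochizukiEtTh2009, Rmk 2.6.1 p.40]; "a bijection as in
Corollary 2.9 fails to hold for `Ẋ̲^log`, `X̲^log`" [cite: MochizukiEtTh2009, Rmk 2.9.1 p.43].

Cell abc-iut, layer L2, discharge seat abc-iut-L2-d3 (nodes EtTh:Rmk2.6.1, EtTh:Rmk2.9.1), companion of
seat abc-iut-L2-t2's `ThetaCoversTempered.lean` (named facts `TemperedCoverData.Rmk261`, `Rmk291_card`; the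
tower `tp PiXuu ⊆ tp PiXu ⊆ tp PiX`, `tp PiCuu ⊆ tp PiCu`, the dotted members `· ⊓ PiCdot`, `autK`,
`cuspOrbits`). RESULTS over `T : TemperedCoverData l`, all UNCONDITIONAL unless marked:

* `PiCuu_le_of_data`, `PiXu_eq_inf`, `PiCu_eq` — `Π_{C̲̲} ⊆ Π_{C̲} = H'`, `Π_{X̲} = H' ∩ Π_X`, `Π_{C̲} = H'`
  in terms of the construction data `(H', E, S, ι̲)` of `Π_{C̲̲}` (Def 2.3);
* `tpPiXu_normal` — `Π^tp_{X̲}` is normal in `Π^tp_C`;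
* `nonempty_autK_tpPiXu_mulEquiv_dihedralGroup` — **`Aut_K(X̲) = N(Π^tp_{X̲})/Π^tp_{X̲} ≅ D_l`**
  (Remark 2.6.1, `X̲`-clause; no `μ_l ⊆ K` needed);
* `normalizer_tpPiCuu_eq` — `N_{Π^tp_C}(Π^tp_{C̲̲}) = Π^tp_{C̲}` under `HasMuL` (`μ_l ⊆ K`), i.e.
  `Aut_K(C̲̲) = Π^tp_{C̲}/Π^tp_{C̲̲}` (the value `≅ ℤ/lℤ` needs the printed definition of `Δ̄_Θ`: `Sec2AutKHolds`);
* `natCard_cuspOrbits_eq_one` — for a NORMAL member `Π^tp_Z` the `Aut_K(Z)`-orbit space of cusps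
  `N(Π^tp_Z)\Π^tp_C/cuspStabC` is a point; hence `rmk291_card_holds : T.Rmk291_card` — **Remark 2.9.1
  DISCHARGED** (one `Aut_K`-orbit of cusps for `X̲` and `Ẋ̲`, both normal in `Π^tp_C`).

No new definition, no named fact; nothing asserts that a `TemperedCoverData` exists; no side is taken on
any disputed claim.
-/

namespace Literature.AnabelianGeometry.EtaleTheta

namespace ThetaCovers

namespace TemperedCoverData

universe u

variable {l : ℕ} (T : TemperedCoverData.{u} l)

/-! ### The tower members in terms of the construction data of `Π_{C̲̲}` -/

section Data

variable {H' E S : Subgroup T.PiC} {ι : T.PiC}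

/-- `Π_{C̲̲} ⊆ Π_{C̲} = H'`. [cite: MochizukiEtTh2009, Def 2.3 p.38] -/
theorem PiCuu_le_of_data (hH' : T.IsTypeLTorsPm H') (hι : T.IsInversion H' ι)
    (hE : T.IsMinusEigen (H' ⊓ T.PiX) H' ι E) (hS : T.IsSplitting S)
    (hdef : T.PiCuu = (S ⊔ E) ⊔ Subgroup.zpowers ι) : T.PiCuu ≤ H' := by
  rw [hdef, ← T.toCoverDataAx.sup_zpowers_sup_barTheta_eq hH' hι hE hS]
  exact le_sup_left

/-- **`Π_{X̲} = Π_{X̲̲}·Δ̄_Θ = H' ∩ Π_X`**: `(S·E)·Δ̄_Θ ⊆ (Π_{C̲̲} ∩ Π_X)·Δ̄_Θ ⊆ (H' ∩ Π_X)·Δ̄_Θ = H' ∩ Π_X =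
(S·E)·Δ̄_Θ`. [cite: MochizukiEtTh2009, Def 2.1 p.36] -/
theorem PiXu_eq_inf (hH' : T.IsTypeLTorsPm H') (hι : T.IsInversion H' ι)
    (hE : T.IsMinusEigen (H' ⊓ T.PiX) H' ι E) (hS : T.IsSplitting S)
    (hdef : T.PiCuu = (S ⊔ E) ⊔ Subgroup.zpowers ι) : T.PiXu = H' ⊓ T.PiX := by
  have hT := hH'.inf_isTypeLTors
  have hle := T.PiCuu_le_of_data hH' hι hE hS hdef
  have hH := T.toCoverDataAx.sup_eigen_sup_barTheta_eq' hH' hE hS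
  unfold PiXu PiXuu
  refine le_antisymm (sup_le (inf_le_inf_right _ hle) hT.barTheta_le) ?_
  rw [← hH]
  refine sup_le_sup_right (le_inf ?_ ?_) _
  · rw [hdef]; exact le_sup_left
  · exact (le_sup_left.trans hH.le).trans inf_le_right

/-- **`Π_{C̲} = Π_{C̲̲}·Δ̄_Θ = H'`**. [cite: MochizukiEtTh2009, Def 2.1 p.36] -/
theorem PiCu_eq (hH' : T.IsTypeLTorsPm H') (hι : T.IsInversion H' ι)
    (hE : T.IsMinusEigen (H' ⊓ T.PiX) H' ι E) (hS : T.IsSplitting S)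
    (hdef : T.PiCuu = (S ⊔ E) ⊔ Subgroup.zpowers ι) : T.PiCu = H' := by
  unfold PiCu
  rw [hdef, T.toCoverDataAx.sup_zpowers_sup_barTheta_eq hH' hι hE hS]

/-- DEPRECATED NAME (interface repair, GAP-LEDGER G-L2d3-5; L2-lead ruling 2026-08-26T05:31Z, path (2) of
abc-iut-c312-8): kept ONLY because the kernel DAG index `Summits/ABC/IUTFork/DAGL2p.lean` (`StatementOf` names
the constant, l.65/l.238/l.241) still names it, until the operator regenerates that index; its STATEMENT is now
that of `isOpen_of_PiXuu_le` — a subgroup of `Π_C` containing `Π_{X̲̲} = Π_{C̲̲} ∩ Π_X` is open (fields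
`isOpen_PiCuu'`, `isOpen_PiX`). (v2's statement «`barKer ≤ H → H` open» rested on the field
`CoverData.isOpen_barKer`, which forces `G_K` finite — `Discharge/Sec2TemperedCoverDataFiniteGK.lean` — and
does not survive `ThetaCovers.lean` v3, where that field becomes `isClosed_barKer`.) Use `isOpen_of_PiXuu_le`.
[cite: MochizukiEtTh2009, Def 2.3 p.38] -/
theorem isOpen_of_barKer_le {H : Subgroup T.PiC} (h : T.PiXuu ≤ H) : IsOpen (H : Set T.PiC) :=
  Subgroup.isOpen_mono h (T.isOpen_PiCuu'.inter T.isOpen_PiX : IsOpen (T.PiXuu : Set T.PiC))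

/-- A subgroup of `Π_C` containing `Π_{X̲̲} = Π_{C̲̲} ∩ Π_X` is open (interface field `isOpen_PiCuu'`,
`isOpen_PiX`; v2: replaces the uses of `isOpen_of_barKer_le`). [cite: MochizukiEtTh2009, Def 2.3 p.38] -/
theorem isOpen_of_PiXuu_le {H : Subgroup T.PiC} (h : T.PiXuu ≤ H) : IsOpen (H : Set T.PiC) :=
  Subgroup.isOpen_mono h (T.isOpen_PiCuu'.inter T.isOpen_PiX : IsOpen (T.PiXuu : Set T.PiC))

end Data

/-! ### Remark 2.6.1, clause `X̲` -/

/-- `Π^tp_{X̲}` is normal in `Π^tp_C` (`Π_{X̲}` is normal in `Π_C`). [cite: MochizukiEtTh2009, Rmk 2.6.1 p.40] -/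
theorem tpPiXu_normal : (T.tp T.PiXu).Normal := by
  obtain ⟨H', E, S, ι, hH', hι, -, hE, hS, hdef⟩ := T.isTypeLTorsThetaPm.out
  rw [T.PiXu_eq_inf hH' hι hE hS hdef]
  exact (T.toCoverDataAx.inf_PiX_normal hH' hι).comap T.toHat

/-- **`Aut_K(X̲^log) = ℤ/lℤ ⋊ {±1}`** (Remark 2.6.1): `N_{Π^tp_C}(Π^tp_{X̲})/Π^tp_{X̲} ≅ D_l`, PROVED over
the interface with NO extra hypothesis (`Π_{X̲}` is normal in `Π_C`; the quotient is dihedral: `Π_X/Π_{X̲} ≅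
ℤ/lℤ` inverted by the involution `ι̲`; transferred to `Π^tp_C` by density).
[cite: MochizukiEtTh2009, Rmk 2.6.1 p.40] -/
theorem nonempty_autK_tpPiXu_mulEquiv_dihedralGroup :
    Nonempty (T.autK (T.tp T.PiXu) ≃* DihedralGroup l) := by
  obtain ⟨H', E, S, ι, hH', hι, h2, hE, hS, hdef⟩ := T.isTypeLTorsThetaPm.out
  have hopen : IsOpen ((H' ⊓ T.PiX : Subgroup T.PiC) : Set T.PiC) :=
    T.PiXu_eq_inf hH' hι hE hS hdef ▸ T.isOpen_of_PiXuu_le (le_sup_left : T.PiXuu ≤ T.PiXu)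
  rw [T.PiXu_eq_inf hH' hι hE hS hdef]
  haveI hN := T.toCoverDataAx.inf_PiX_normal hH' hι
  obtain ⟨e1⟩ := T.nonempty_autK_tp_mulEquiv hopen
  have htop := T.toCoverDataAx.normalizer_inf_PiX_eq_top hH' hι
  haveI : ((H' ⊓ T.PiX).subgroupOf (⊤ : Subgroup T.PiC)).Normal := hN.subgroupOf _
  obtain ⟨e2⟩ := nonempty_quotient_subgroupOf_congr (K := H' ⊓ T.PiX) htop
  obtain ⟨e3⟩ := nonempty_top_quotient_mulEquiv (H' ⊓ T.PiX)
  obtain ⟨e4⟩ := T.toCoverDataAx.nonempty_quotient_inf_PiX_mulEquiv_dihedralGroup hH' hι h2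
  exact ⟨e1.trans (e2.trans (e3.trans e4))⟩

/-! ### Remark 2.6.1, clause `C̲̲`: the normaliser -/

/-- **`N_{Π^tp_C}(Π^tp_{C̲̲}) = Π^tp_{C̲}`** under `μ_l ⊆ K` (`HasMuL`): `Aut_K(C̲̲) = Π^tp_{C̲}/Π^tp_{C̲̲}`
(`N_{Π_C}(Π_{C̲̲}) = Π_{C̲}` transferred by density). [cite: MochizukiEtTh2009, Rmk 2.6.1 p.40] -/
theorem normalizer_tpPiCuu_eq (hmu : T.HasMuL) :
    Subgroup.normalizer ((T.tp T.PiCuu : Subgroup T.Gtp) : Set T.Gtp) = T.tp T.PiCu := by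
  obtain ⟨H', E, S, ι, hH', hι, -, hE, hS, hdef⟩ := T.isTypeLTorsThetaPm.out
  have hopen : IsOpen ((T.PiCuu : Subgroup T.PiC) : Set T.PiC) := T.isOpen_PiCuu'
  rw [T.normalizer_tp_eq_of_isOpen hopen, T.PiCu_eq hH' hι hE hS hdef, hdef,
    T.toCoverDataAx.normalizer_sup_zpowers_eq hmu hH' hι hE hS]

/-! ### Remark 2.9.1 -/

/-- For a member `Z` of the tower whose `Π^tp_Z` is NORMAL in `Π^tp_C`, the space of `Aut_K(Z)`-orbits of
cusps `N(Π^tp_Z)\Π^tp_C/cuspStabC` is a single point (whatever the cusp stabiliser).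
[cite: MochizukiEtTh2009, Rmk 2.9.1 p.43] -/
theorem natCard_cuspOrbits_eq_one {S : Subgroup T.Gtp}
    (hS : Subgroup.normalizer ((S : Subgroup T.Gtp) : Set T.Gtp) = ⊤) :
    Nat.card (T.cuspOrbits S) = 1 := by
  rw [Nat.card_eq_one_iff_unique]
  refine ⟨⟨fun a b => ?_⟩, ⟨DoubleCoset.mk _ _ 1⟩⟩
  induction a using Quotient.inductionOn' with
  | h a =>
    induction b using Quotient.inductionOn' with
    | h b =>
      change DoubleCoset.mk _ _ a = DoubleCoset.mk _ _ b
      rw [DoubleCoset.eq]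
      refine ⟨b * a⁻¹, ?_, 1, Subgroup.one_mem _, by group⟩
      rw [hS]
      exact Subgroup.mem_top _

/-- **Remark 2.9.1 DISCHARGED**: "a bijection as in Corollary 2.9 fails to hold for `Ẋ̲^log`, `X̲^log`" —
in t2's cardinality form `T.Rmk291_card`: for `X̲` and `Ẋ̲` there is exactly ONE `Aut_K`-orbit of cusps,
because `Π^tp_{X̲}` and `Π^tp_{Ẋ̲} = Π^tp_{X̲} ∩ Π^tp_Ċ` are normal in `Π^tp_C` (`Aut_K(X̲) ⊇ Gal(X̲/C)` acts
transitively). PROVED over the interface with no extra hypothesis (not even `μ_l ⊆ K`).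
[cite: MochizukiEtTh2009, Rmk 2.9.1 p.43] -/
theorem rmk291_card_holds : T.Rmk291_card := by
  intro _ S hS
  haveI h1 : (T.tp T.PiXu).Normal := T.tpPiXu_normal
  haveI h2 : T.PiCdot.Normal := Subgroup.normal_of_index_eq_two T.index_PiCdot
  simp only [List.mem_cons, List.not_mem_nil, or_false] at hS
  rcases hS with rfl | rfl
  · haveI : (T.tp T.PiXu ⊓ T.PiCdot).Normal := inferInstance
    exact T.natCard_cuspOrbits_eq_one (Subgroup.normalizer_eq_top (H := T.tp T.PiXu ⊓ T.PiCdot))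
  · exact T.natCard_cuspOrbits_eq_one (Subgroup.normalizer_eq_top (H := T.tp T.PiXu))

end TemperedCoverData

end ThetaCovers

end Literature.AnabelianGeometry.EtaleTheta
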